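import Summits.QuantumFields.YangMills.Theorems.BalabanUVNodesN15BackgroundMatrixByParts
import Summits.QuantumFields.YangMills.Theorems.BalabanUVNodesN15VectorPieceBackgroundMatrix
import HarnessLib

/-!
# THE BY-PARTS ENTRY-2 DEVICE FOR THE NON-ABELIAN (MATRIX) FIRST-ORDER SPECIES WITH BOTH BOND ORIENTATIONS: `V̂ = M_C + Σ_μ [M_{A_μ}∇_μ + M_{B_μ}∇⁻_μ]` — the multiplier
# `M_{C − Σ_μ[(∇_μA_μ)∘e_μ⁻¹ + ∇_μB_μ]}`, the identification `E₀∘∇_ν* = E₂∘ι_ν` for M1's pair over the doubled direction set `J ⊕ J`, and the backward-coefficient letters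
# (dag-n15-c g9, FILE 18; Track-A node N15 = NE2, s1 «background-layer OPERATOR ingredient»)

`--kind proof --supports stmt-QuantumFields-20544 --as helper` (K3⁷; count-neutral).  Imports BY NAME this seat's g8 FILE 12 `…N15BackgroundMatrixByParts` (`fgradMat`, `mmulOp_sub`,
`mmulOp_sum`, `mmulOp_comp_pull`, `smul_mmulOp_sub_eq`, `hasMaj_mmulOp_translate`, `hasMaj_idef_mmulOp_translate`; through it FILES 1–6: `fgrad`, `bgrad`, `fgradAdj`, `rightPert`,
`byPartsMult`, `byPartsFactor`, `e2ByParts`, `E2Unit`, `bopOf`, `krowOf`, `injJ`, `sumJ`, `e0_comp_fgradAdj_eq_e2ByParts`, `projO_bgPropV_fix_right`, M1 `unstackM` ∕ `bgPairM`,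
`PairSpace.stack` ∕ `projO`, `MatrixSpecies.mmulOp` ∕ `liftEquiv` ∕ `hasMaj_mmulOp` ∕ `hasMaj_idef_mmulOp`; FILE 4 `symbOp_sD_eq`, W1 `bshiftV`, part 39 `gOp`) and g0 M4
`…N15VectorPieceBackgroundMatrix` (`tensorId`); nothing in the tree is modified.

WHY.  Bałaban's `V′₁(A)` of (3.52) p.400 is `M_c + Σ_μ [M_{a⁺_μ}∇_μ + M_{a⁻_μ}∇⁻_μ]` with BOTH bond orientations (`∇⁻_μ = S_{−μ}∇_μ`, FILE 1 `bgrad`); FILE 12 ran the by-parts device for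
the forward orientation only (`C^b = 0`).  FILE 1's closed system `e2_closed_system` was stated for both: the backward term integrates by parts as
`E₀M_B∇⁻_μ = −(E₀∇_μ*)∘M_{B∘e_μ} − E₀∘M_{∇_μB}` (`M_B∘S_μ⁻¹ = S_μ⁻¹∘M_{B∘e_μ}`) — NO new `U ≡ 1` object: the same `E₀∇_μ*`, shifts and translated coefficients.  This file
supplies the matrix-species algebra for both orientations so that FILES 13∕14∕16∕17's layer ∕ node ∕ torus instance ∕ primitive carrier get two-sided twins.

CONTENTS ([folklore] algebra + bookkeeping; 0 def).
* §1 `mmulOp_add`, `mmulOp_comp_pull_symm` (`M_B∘S_e⁻¹ = S_e⁻¹∘M_{B∘e}`), `smul_mmulOp_translate_sub_eq` (`n(M_{B∘e} − M_B) = M_{∇B}`).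
* §2 `byPartsMult_matrix₂` (`R̃ = M_{C − Σ_μ[(∇_μA_μ)∘e_μ⁻¹ + ∇_μB_μ]}`), `unstackM₂_comp_stack_eq_rightPert` (M1's `unstackM C (Sum.elim A B)` after the stack of `G`, the FORWARD derived
  pieces on `inl` and the BACKWARD ones on `inr` IS FILE 1's `rightPert` with `C^a = M_A`, `C^b = M_B`), ★ `projO_bgPairM₂_fix_right`, ★★ `e0_comp_fgradAdj_eq_e2ByParts_matrix₂`
  (IDENTIFICATION, both orientations: `E₀∘∇_ν* = e2ByParts B̂ K̂ ∘ ι_ν` with rows `S_μM_{A_μ∘e_μ⁻¹} + M_{B_μ∘e_μ}`; NO mixed piece).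
* §3 letters: `hasMaj_mmulOp_translate_fwd` (`M_{B∘e} ≤ diagK r`), `hasMaj_byPartsMult_matrix₂` (`≤ diagK (r + |J|(r₁ + r₁))` from row sums of `C`, `∇A`, `∇B`),
  `hasMaj_idef_byPartsMult_matrix₂` (`≤ diagK (o + |J|(o + o))`), `hasMaj_idef_mmulOp_translate_fwd`.
* §4 the torus's backward derived piece `∇⁻_μG = bgrad n (bshiftEquiv μ) ∘ gOp`: `bgrad_eq_bshiftV_comp_fgrad`, `bgrad_comp_gOp_eq` (= g7 G5's object `S_{−μ}∘(ρ(sD_μ)∘gOp)`, FILE 4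
  `symbOp_sD_eq`), `bgrad_liftEquiv_comp` (`(∇⁻ ⊗ 1)∘(T ⊗ 1) = (∇⁻∘T) ⊗ 1` — the `hDb` shape of §2, M4 `tensorId`).

HONEST FRAMING.  Algebra and bookkeeping for the matrix species with both orientations; the coefficient matrices `C`, `A_μ`, `B_μ` are FREE data here (their derivation from ONE
gauge field through `ad`-polynomials — (3.52)'s `c`, `a⁺_μ`, `a⁻_μ` — is the sequel's); nothing about Bałaban's `G(U)` asserted; N15 not discharged; nothing continuum ∕ OS ∕ mass-gap ∕
Clay.
-/

noncomputable section

open scoped BigOperators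
open Finset

namespace Summit.QuantumFields.YangMills.BalabanUVNodes.N15.BackgroundLayer

open Literature.MathematicalPhysics.QuantumFieldTheory.Balaban1983to89
open Literature.MathematicalPhysics.QuantumFieldTheory.Balaban1983to89.B11SectG (BlockNorm HasMaj hasMaj_zero)
open Literature.MathematicalPhysics.QuantumFieldTheory.Balaban1983to89.T4EtaRateDefect (idef idef_apply idef_zero)
open Literature.MathematicalPhysics.QuantumFieldTheory.Balaban1983to89.T4EtaRateCoeffDefect (pull pull_apply diagK diagK_nonneg)
open Summit.QuantumFields.YangMills.BalabanUVNodes.N15.MatrixSpecies (mmulOp mmulOp_apply liftEquiv liftEquiv_apply liftEquiv_symm_apply liftMap liftBlk hasMaj_mmulOp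
  hasMaj_idef_mmulOp)
open Literature.MathematicalPhysics.QuantumFieldTheory.Balaban1983to89.B5Prop11Plancherel (Tor fine unitVec)
open Summit.QuantumFields.YangMills.BalabanUVNodes.N15.TwoGrid (gOp symbOp sD)
open Summit.QuantumFields.YangMills.BalabanUVNodes.N15.VectorPiece (bshiftEquiv bshiftEquiv_apply bshiftEquiv_symm_apply bshiftV bshiftV_apply tensorId tensorId_apply)

variable {d : ℕ}

/-! ## §1 Matrix multiplication operators: additivity, the BACKWARD translation intertwiner, the entrywise quotient of a forward-translated coefficient -/

section Algebra

variable {X ι J : Type} [Fintype ι]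

/-- `mmulOp` is additive: `M_{C + C′} = M_C + M_{C′}`. [folklore] -/
theorem mmulOp_add (C C' : X → Matrix ι ι ℝ) : mmulOp (C + C') = mmulOp C + mmulOp C' := by
  refine LinearMap.ext fun f => funext fun p => ?_
  simp only [mmulOp_apply, LinearMap.add_apply, Pi.add_apply, Matrix.add_apply, add_mul, Finset.sum_add_distrib]

/-- THE BACKWARD TRANSLATION INTERTWINER: `M_B ∘ S_e⁻¹ = S_e⁻¹ ∘ M_{B∘e}` for the lifted translation `S_e = pull (liftEquiv e ι)` (FILE 1's `hCb` shape). [folklore] -/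
theorem mmulOp_comp_pull_symm (B : X → Matrix ι ι ℝ) (e : X ≃ X) :
    mmulOp B ∘ₗ pull ⇑(liftEquiv e ι).symm = pull ⇑(liftEquiv e ι).symm ∘ₗ mmulOp (B ∘ e) := by
  refine LinearMap.ext fun f => funext fun p => ?_
  simp only [LinearMap.comp_apply, mmulOp_apply, pull_apply, liftEquiv_symm_apply, Function.comp_apply, Equiv.apply_symm_apply]

/-- THE BACKWARD LEIBNIZ REMAINDER AS A MULTIPLICATION: `n·(M_{B∘e} − M_B) = M_{∇B}` (untranslated entrywise quotient). [folklore] -/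
theorem smul_mmulOp_translate_sub_eq (n : ℝ) (e : X ≃ X) (B : X → Matrix ι ι ℝ) : n • (mmulOp (B ∘ e) - mmulOp B) = mmulOp (fgradMat n e B) := by
  refine LinearMap.ext fun f => funext fun p => ?_
  simp only [LinearMap.smul_apply, LinearMap.sub_apply, Pi.smul_apply, Pi.sub_apply, mmulOp_apply, Function.comp_apply, fgradMat, Matrix.smul_apply, Matrix.sub_apply,
    smul_eq_mul, Finset.mul_sum, ← Finset.sum_sub_distrib]
  exact Finset.sum_congr rfl fun j _ => by ring

end Algebra

/-! ## §2 The two-sided matrix species: by-parts multiplier, the pair over `J ⊕ J`, the RIGHT (3.65), the identification -/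

section Species

variable {X ι J : Type} [Fintype ι] [Fintype J] (τ : J → X ≃ X) (n : ℝ) (G : (X × ι → ℝ) →ₗ[ℝ] (X × ι → ℝ))
  (C : X → Matrix ι ι ℝ) (A : J ⊕ J → X → Matrix ι ι ℝ)

/-- THE BY-PARTS MULTIPLIER OF THE TWO-SIDED MATRIX SPECIES: `R̃ = M_{C − Σ_μ [(∇_μA_μ)∘e_μ⁻¹ + ∇_μB_μ]}` (forward coefficients `A_μ`, backward coefficients `B_μ`).
[cite: Balaban1985BackgroundPropagators, (3.52) p.400 (shape: both orientations); by-parts form ours] -/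
theorem byPartsMult_matrix₂ :
    byPartsMult n (mmulOp C) (fun μ => mmulOp (A (Sum.inl μ))) (fun μ => mmulOp (A (Sum.inl μ) ∘ ⇑(τ μ).symm)) (fun μ => mmulOp (A (Sum.inr μ))) (fun μ => mmulOp (A (Sum.inr μ) ∘ ⇑(τ μ))) =
      mmulOp (C - ∑ μ, (fgradMat n (τ μ) (A (Sum.inl μ)) ∘ ⇑(τ μ).symm + fgradMat n (τ μ) (A (Sum.inr μ)))) := by
  rw [byPartsMult, mmulOp_sub, mmulOp_sum]
  congr 1
  refine Finset.sum_congr rfl fun μ _ => ?_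
  rw [smul_add, smul_mmulOp_sub_eq, smul_mmulOp_translate_sub_eq, mmulOp_add]

/-- THE RIGHT PERTURBATION OF THE TWO-SIDED MATRIX SPECIES IS M1's UNSTACKED PERTURBATION OVER THE DOUBLED DIRECTION SET `J ⊕ J` AFTER THE STACK: `W = V̂∘Ĝ = M_CG +
Σ_μ [M_{A_μ}∇_μG + M_{B_μ}∇⁻_μG]` when the derived pieces on `inl μ` ARE the forward quotients `∇_μG` and those on `inr μ` the backward ones `∇⁻_μG = S_{−μ}∇_μG` (FILE 1 `bgrad`)
along the lifted translations. [cite: Balaban1985BackgroundPropagators, (3.52) p.400, (3.63)–(3.64) p.402 (shapes)] -/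
theorem unstackM₂_comp_stack_eq_rightPert {D : J ⊕ J → (X × ι → ℝ) →ₗ[ℝ] (X × ι → ℝ)} (hDf : ∀ μ, D (Sum.inl μ) = fgrad n (liftEquiv (τ μ) ι) ∘ₗ G)
    (hDb : ∀ μ, D (Sum.inr μ) = bgrad n (liftEquiv (τ μ) ι) ∘ₗ G) :
    unstackM C A ∘ₗ stack G D = rightPert (fun μ => liftEquiv (τ μ) ι) n G (mmulOp C) (fun μ => mmulOp (A (Sum.inl μ))) (fun μ => mmulOp (A (Sum.inr μ))) := by
  rw [unstackM, rightPert, LinearMap.add_comp, linearMap_sum_comp, LinearMap.comp_assoc, projO_none_comp_stack]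
  congr 1
  rw [Fintype.sum_sum_type, ← Finset.sum_add_distrib]
  refine Finset.sum_congr rfl fun μ _ => ?_
  rw [LinearMap.comp_assoc, projO_some_comp_stack, LinearMap.comp_assoc, projO_some_comp_stack, hDf μ, hDb μ]

variable [Fintype X] [DecidableEq X] [DecidableEq ι] [DecidableEq J]

/-- ★ **`hE0` FOR M1's TWO-SIDED NON-ABELIAN PAIR**: the dressed entry 0 `E₀ = pr₀X̂`, `X̂ = bgPairM G D C (Sum.elim A B)` over `J ⊕ J`, solves the RIGHT fixed-point equation of FILE 1's
`e2_closed_system` with the two-sided matrix species data, whenever the derived pieces are the forward ∕ backward quotients of `G` and `1 − [ĜV̂]` is a unit (FILE 5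
`projO_bgPropV_fix_right`). [cite: Balaban1985BackgroundPropagators, (3.64)–(3.65) p.402 (mechanism)] -/
theorem projO_bgPairM₂_fix_right {D : J ⊕ J → (X × ι → ℝ) →ₗ[ℝ] (X × ι → ℝ)} (hDf : ∀ μ, D (Sum.inl μ) = fgrad n (liftEquiv (τ μ) ι) ∘ₗ G)
    (hDb : ∀ μ, D (Sum.inr μ) = bgrad n (liftEquiv (τ μ) ι) ∘ₗ G) (hunit : IsUnit (1 - LinearMap.toMatrix' (stack G D ∘ₗ unstackM C A))) :
    projO none ∘ₗ bgPairM G D C A =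
      G + (projO none ∘ₗ bgPairM G D C A) ∘ₗ rightPert (fun μ => liftEquiv (τ μ) ι) n G (mmulOp C) (fun μ => mmulOp (A (Sum.inl μ))) (fun μ => mmulOp (A (Sum.inr μ))) := by
  rw [← unstackM₂_comp_stack_eq_rightPert τ n G C A hDf hDb, bgPairM]
  exact projO_bgPropV_fix_right hunit

/-- ★★ **IDENTIFICATION FOR THE TWO-SIDED MATRIX SPECIES**: under the unit hypotheses, the by-parts entry-2 object built on `S_ν = G∇_ν*` (`∇_ν* = fgradAdj n (liftEquiv e_ν ι)`),
`E₀ = pr₀(bgPairM G D C A)`, the multiplier `M_{C − Σ_μ[(∇A)∘e⁻¹ + ∇B]}` and the rows `S_μM_{A_μ∘e_μ⁻¹} + M_{B_μ∘e_μ}` IS `E₀∘∇_ν*` — the two-sided non-abelian dressed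
propagator composed with `∇_ν*`; no mixed piece `∇_μG∇_ν*` or `∇⁻_μG∇_ν*` is a letter of the right-hand side. [cite: Balaban1985BackgroundPropagators, (3.52) p.400 + (3.64)–(3.65) p.402 (mechanism); by-parts form ours] -/
theorem e0_comp_fgradAdj_eq_e2ByParts_matrix₂ {D : J ⊕ J → (X × ι → ℝ) →ₗ[ℝ] (X × ι → ℝ)} (hDf : ∀ μ, D (Sum.inl μ) = fgrad n (liftEquiv (τ μ) ι) ∘ₗ G)
    (hDb : ∀ μ, D (Sum.inr μ) = bgrad n (liftEquiv (τ μ) ι) ∘ₗ G) (hunit : IsUnit (1 - LinearMap.toMatrix' (stack G D ∘ₗ unstackM C A)))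
    (hunit2 : E2Unit (krowOf (fun ν => G ∘ₗ fgradAdj n (liftEquiv (τ ν) ι)) (fun μ => pull (liftEquiv (τ μ) ι)) (fun μ => mmulOp (A (Sum.inl μ) ∘ ⇑(τ μ).symm))
      (fun μ => mmulOp (A (Sum.inr μ) ∘ ⇑(τ μ))))) (ν : J) :
    (projO none ∘ₗ bgPairM G D C A) ∘ₗ fgradAdj n (liftEquiv (τ ν) ι) =
      e2ByParts (bopOf (fun ν => G ∘ₗ fgradAdj n (liftEquiv (τ ν) ι)) (projO none ∘ₗ bgPairM G D C A)
          (mmulOp (C - ∑ μ, (fgradMat n (τ μ) (A (Sum.inl μ)) ∘ ⇑(τ μ).symm + fgradMat n (τ μ) (A (Sum.inr μ))))))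
        (krowOf (fun ν => G ∘ₗ fgradAdj n (liftEquiv (τ ν) ι)) (fun μ => pull (liftEquiv (τ μ) ι)) (fun μ => mmulOp (A (Sum.inl μ) ∘ ⇑(τ μ).symm))
          (fun μ => mmulOp (A (Sum.inr μ) ∘ ⇑(τ μ)))) ∘ₗ injJ ν := by
  rw [← byPartsMult_matrix₂ τ n C A]
  exact e0_comp_fgradAdj_eq_e2ByParts (projO_bgPairM₂_fix_right τ n G C A hDf hDb hunit) (fun μ => mmulOp_comp_pull (A (Sum.inl μ)) (τ μ))
    (fun μ => mmulOp_comp_pull_symm (A (Sum.inr μ)) (τ μ)) hunit2 ν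

end Species

/-! ## §3 The two-sided matrix coefficient letters (row sums and row fits) -/

section Letters

variable {X X' ι J : Type} [Fintype X] [Fintype X'] [Fintype ι] [DecidableEq ι] [Fintype J] [DecidableEq J] {g : B6.Geometry} (blk : X → g.Site) (π : X' → X)
variable {τ : J → X ≃ X} {τ' : J → X' ≃ X'} {n n' : ℝ} {C : X → Matrix ι ι ℝ} {A B : J → X → Matrix ι ι ℝ} {C' : X' → Matrix ι ι ℝ} {A' B' : J → X' → Matrix ι ι ℝ}
  {r r₁ o : ℝ}

omit [Fintype X'] [Fintype J] [DecidableEq J] [DecidableEq ι] in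
/-- forward-translated backward coefficient: `M_{B∘e} ≤ diagK r` from the row sums `Σ_j |B_{ij}| ≤ r`. [folklore] -/
theorem hasMaj_mmulOp_translate_fwd (hr : 0 ≤ r) (hB : ∀ μ x i, ∑ j, |B μ x i j| ≤ r) (μ : J) :
    HasMaj (BlockNorm.ofBlocks g (liftBlk blk ι)) (BlockNorm.ofBlocks g (liftBlk blk ι)) (mmulOp (B μ ∘ ⇑(τ μ))) (diagK fun _ => r) :=
  hasMaj_mmulOp blk (fun _ => hr) fun x i => hB μ (τ μ x) i

omit [Fintype X'] [DecidableEq J] [DecidableEq ι] in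
/-- THE TWO-SIDED BY-PARTS MULTIPLIER `M_{C − Σ_μ[(∇A)∘e⁻¹ + ∇B]} ≤ diagK (r + |J|·(r₁ + r₁))` from the row sums of `C` (`≤ r`) and of the GRADIENTS `∇_μA_μ`, `∇_μB_μ` (`≤ r₁`).
[folklore] -/
theorem hasMaj_byPartsMult_matrix₂ (hr : 0 ≤ r) (hr₁ : 0 ≤ r₁) (hC : ∀ x i, ∑ j, |C x i j| ≤ r) (hgA : ∀ μ x i, ∑ j, |fgradMat n (τ μ) (A μ) x i j| ≤ r₁)
    (hgB : ∀ μ x i, ∑ j, |fgradMat n (τ μ) (B μ) x i j| ≤ r₁) :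
    HasMaj (BlockNorm.ofBlocks g (liftBlk blk ι)) (BlockNorm.ofBlocks g (liftBlk blk ι))
      (mmulOp (C - ∑ μ, (fgradMat n (τ μ) (A μ) ∘ ⇑(τ μ).symm + fgradMat n (τ μ) (B μ)))) (diagK fun _ => r + Fintype.card J * (r₁ + r₁)) := by
  refine hasMaj_mmulOp blk (fun _ => by positivity) fun x i => ?_
  calc ∑ j, |(C - ∑ μ, (fgradMat n (τ μ) (A μ) ∘ ⇑(τ μ).symm + fgradMat n (τ μ) (B μ))) x i j|
      ≤ ∑ j, (|C x i j| + ∑ μ, (|fgradMat n (τ μ) (A μ) ((τ μ).symm x) i j| + |fgradMat n (τ μ) (B μ) x i j|)) := Finset.sum_le_sum fun j _ => by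
        rw [Pi.sub_apply, Matrix.sub_apply, Finset.sum_apply, Matrix.sum_apply]
        refine (abs_sub _ _).trans (add_le_add le_rfl ?_)
        refine (Finset.abs_sum_le_sum_abs _ _).trans (Finset.sum_le_sum fun μ _ => ?_)
        rw [Pi.add_apply, Matrix.add_apply]
        exact abs_add_le _ _
    _ = ∑ j, |C x i j| + ∑ μ, (∑ j, |fgradMat n (τ μ) (A μ) ((τ μ).symm x) i j| + ∑ j, |fgradMat n (τ μ) (B μ) x i j|) := by
        rw [Finset.sum_add_distrib, Finset.sum_comm]
        simp only [Finset.sum_add_distrib]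
    _ ≤ r + ∑ _μ : J, (r₁ + r₁) := add_le_add (hC x i) (Finset.sum_le_sum fun μ _ => add_le_add (hgA μ _ i) (hgB μ x i))
    _ = r + Fintype.card J * (r₁ + r₁) := by rw [Finset.sum_const, Finset.card_univ, nsmul_eq_mul]

omit [DecidableEq J] [DecidableEq ι] in
/-- ITS η-DEFECT `≤ diagK (o + |J|·(o + o))` from the row fits of `C′ − C∘π`, of `(∇′A′)∘e′⁻¹ − ((∇A)∘e⁻¹)∘π` and of `∇′B′ − (∇B)∘π`. [folklore] -/
theorem hasMaj_idef_byPartsMult_matrix₂ (ho : 0 ≤ o) (hfC : ∀ x' i, ∑ j, |C' x' i j - C (π x') i j| ≤ o)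
    (hfgA : ∀ μ x' i, ∑ j, |fgradMat n' (τ' μ) (A' μ) ((τ' μ).symm x') i j - fgradMat n (τ μ) (A μ) ((τ μ).symm (π x')) i j| ≤ o)
    (hfgB : ∀ μ x' i, ∑ j, |fgradMat n' (τ' μ) (B' μ) x' i j - fgradMat n (τ μ) (B μ) (π x') i j| ≤ o) :
    HasMaj (BlockNorm.ofBlocks g (liftBlk blk ι)) (BlockNorm.ofBlocks g (liftBlk (blk ∘ π) ι))
      (idef (pull (liftMap π ι)) (pull (liftMap π ι)) (mmulOp (C' - ∑ μ, (fgradMat n' (τ' μ) (A' μ) ∘ ⇑(τ' μ).symm + fgradMat n' (τ' μ) (B' μ))))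
        (mmulOp (C - ∑ μ, (fgradMat n (τ μ) (A μ) ∘ ⇑(τ μ).symm + fgradMat n (τ μ) (B μ)))))
      (diagK fun _ => o + Fintype.card J * (o + o)) := by
  refine hasMaj_idef_mmulOp blk π (fun _ => by positivity) fun x' i => ?_
  calc ∑ j, |(C' - ∑ μ, (fgradMat n' (τ' μ) (A' μ) ∘ ⇑(τ' μ).symm + fgradMat n' (τ' μ) (B' μ))) x' i j -
          (C - ∑ μ, (fgradMat n (τ μ) (A μ) ∘ ⇑(τ μ).symm + fgradMat n (τ μ) (B μ))) (π x') i j|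
      ≤ ∑ j, (|C' x' i j - C (π x') i j| +
          ∑ μ, (|fgradMat n' (τ' μ) (A' μ) ((τ' μ).symm x') i j - fgradMat n (τ μ) (A μ) ((τ μ).symm (π x')) i j| +
            |fgradMat n' (τ' μ) (B' μ) x' i j - fgradMat n (τ μ) (B μ) (π x') i j|)) :=
        Finset.sum_le_sum fun j _ => by
          rw [Pi.sub_apply, Pi.sub_apply, Matrix.sub_apply, Matrix.sub_apply, Finset.sum_apply, Finset.sum_apply, Matrix.sum_apply, Matrix.sum_apply,
            sub_sub_sub_comm, ← Finset.sum_sub_distrib]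
          refine (abs_sub _ _).trans (add_le_add le_rfl ?_)
          refine (Finset.abs_sum_le_sum_abs _ _).trans (Finset.sum_le_sum fun μ _ => ?_)
          rw [Pi.add_apply, Pi.add_apply, Matrix.add_apply, Matrix.add_apply, add_sub_add_comm]
          exact abs_add_le _ _
    _ = ∑ j, |C' x' i j - C (π x') i j| +
          ∑ μ, (∑ j, |fgradMat n' (τ' μ) (A' μ) ((τ' μ).symm x') i j - fgradMat n (τ μ) (A μ) ((τ μ).symm (π x')) i j| +
            ∑ j, |fgradMat n' (τ' μ) (B' μ) x' i j - fgradMat n (τ μ) (B μ) (π x') i j|) := by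
        rw [Finset.sum_add_distrib, Finset.sum_comm]
        simp only [Finset.sum_add_distrib]
    _ ≤ o + ∑ _μ : J, (o + o) := add_le_add (hfC x' i) (Finset.sum_le_sum fun μ _ => add_le_add (hfgA μ x' i) (hfgB μ x' i))
    _ = o + Fintype.card J * (o + o) := by rw [Finset.sum_const, Finset.card_univ, nsmul_eq_mul]

omit [Fintype J] [DecidableEq J] [DecidableEq ι] in
/-- THE η-DEFECT OF THE FORWARD-TRANSLATED BACKWARD COEFFICIENTS `≤ diagK o` from the translated row fit `Σ_j |B′(e′x′) − B(e(πx′))| ≤ o`. [folklore] -/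
theorem hasMaj_idef_mmulOp_translate_fwd (μ : J) (ho : 0 ≤ o) (hfB : ∀ x' i, ∑ j, |B' μ (τ' μ x') i j - B μ (τ μ (π x')) i j| ≤ o) :
    HasMaj (BlockNorm.ofBlocks g (liftBlk blk ι)) (BlockNorm.ofBlocks g (liftBlk (blk ∘ π) ι))
      (idef (pull (liftMap π ι)) (pull (liftMap π ι)) (mmulOp (B' μ ∘ ⇑(τ' μ))) (mmulOp (B μ ∘ ⇑(τ μ)))) (diagK fun _ => o) :=
  hasMaj_idef_mmulOp blk π (fun _ => ho) fun x' i => hfB x' i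

end Letters

/-! ## §4 The scalar backward derived piece `∇⁻_μG` of the full propagator and its lift to `𝔤`-valued 1-forms (the torus instance's `inr` pieces) -/

section Backward

/-- `∇⁻_μ = S_{−μ}∘∇_μ` on the torus 1-forms. [folklore] -/
theorem bgrad_eq_bshiftV_comp_fgrad (M : Fin (d + 1) → ℕ) [∀ μ, NeZero (M μ)] (n : ℕ) [NeZero n] (μ : Fin (d + 1)) :
    bgrad (n : ℝ) (bshiftEquiv M n μ) = bshiftV M n μ ∘ₗ fgrad (n : ℝ) (bshiftEquiv M n μ) := by
  refine LinearMap.ext fun f => funext fun i => ?_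
  simp only [bgrad_apply, LinearMap.comp_apply, bshiftV_apply, fgrad_apply, bshiftEquiv_apply, bshiftEquiv_symm_apply, sub_add_cancel]

/-- THE BACKWARD DERIVED PIECE `∇⁻_μG = bgrad n (bshiftEquiv μ) ∘ gOp` of the full propagator IS g7 G5's OBJECT `S_{−μ}∘(ρ(sD_μ)∘G)` (FILE 4 `symbOp_sD_eq`).
[cite: Balaban1985BackgroundPropagators, (3.52) p.400 (the backward derivative in `V′₁`: shape)] -/
theorem bgrad_comp_gOp_eq (M : Fin (d + 1) → ℕ) [∀ μ, NeZero (M μ)] (n : ℕ) [NeZero n] (b : ℝ) (μ : Fin (d + 1)) :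
    bgrad (n : ℝ) (bshiftEquiv M n μ) ∘ₗ gOp M n b = bshiftV M n μ ∘ₗ (symbOp M n (sD M n μ (n : ℝ)) ∘ₗ gOp M n b) := by
  rw [bgrad_eq_bshiftV_comp_fgrad, symbOp_sD_eq, LinearMap.comp_assoc]

/-- `∇̂⁻_e∘(T ⊗ 1) = (∇⁻_e∘T) ⊗ 1` for the lifted backward difference quotient `∇̂⁻_e = bgrad n (liftEquiv e ι)`. [folklore] -/
theorem bgrad_liftEquiv_comp {X X₂ : Type} (ι : Type) (n : ℝ) (e : X ≃ X) (T : (X₂ → ℝ) →ₗ[ℝ] (X → ℝ)) :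
    bgrad n (liftEquiv e ι) ∘ₗ tensorId ι T = tensorId ι (bgrad n e ∘ₗ T) := by
  refine LinearMap.ext fun f => funext fun p => ?_
  simp only [LinearMap.comp_apply, bgrad_apply, tensorId_apply, liftEquiv_symm_apply]

end Backward

end Summit.QuantumFields.YangMills.BalabanUVNodes.N15.BackgroundLayer

end
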